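import Summits.BirchSwinnertonDyer.BirchSwinnertonDyer.Theorems.EisensteinPrimesX2AnalyticMuBound
import Summits.BirchSwinnertonDyer.BirchSwinnertonDyer.Theorems.EisensteinPrimesAnalyticLambdaCruxSized
import Summits.BirchSwinnertonDyer.BirchSwinnertonDyer.Theorems.EisensteinPrimesMazurMCOnCellBCongruenceRoadMuPart
import HarnessLib

/-!
# Crux `MazurMCOnCellB` (stmt-BirchSwinnertonDyer-19033), line `mudescent`: the TIGHT form of the two
# open stubs AT A PAIR — Mazur's main conjecture at an X2b pair ⟺ (μ-part ∧ λ-count), and the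
# registered μ-stub's conclusion ⟺ μ-part ∧ Greenberg's `μ = 0` (helper; closes nothing; route-independent imports)

Cell `bsd-eis`, D-0154 width seat `bsd-line-x2-p1-w2` (gen 2) on crux 3 (row A10, X2b), skeleton of
record `Cruxes/MazurMCOnCellB/Lines/mudescent.lean` (`bcae135b…`; stubs `stub_publishedInputs` [FACT],
`stub_analyticMuZero_offLocus` [OPEN, this lineage], `stub_lambdaCount_offLocus` [OPEN, LEAD]). Sequel
of `EisensteinPrimesX2AnalyticMuBound` (same seat: at a rank-`0` pair `∃ m, X2.AnalyticMuLE W p m` —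
the Mazur–Tate–Teitelbaum function does not vanish). The class-wide forms BY THE CRUX'S NAME are in
the third file `EisensteinPrimesMazurMCOnCellBMuPartTightCrux` (which alone imports the route file).

THE POINT. The registered composition `MazurMCOnCellB_of` feeds route T
(`X2.mazurMainConjectureAt_of_algebraicLambdaGE`: `μ_an(W₀) = 0 ∧ λ_an(W₀) = n ∧ λ(X(W₀/ℚ_∞)) ≥ k ∧
n ≤ k + e ⇒` MC at the étale end `W₀`). Its `μ`-input `μ_an(W₀) = 0` (stub 3) is Greenberg's
μ-conjecture on X2b (gen 0: `…MuEtaleEnd.stub_iff_greenbergMu_of_mazurMCOnCellB`), i.e. MORE than the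
crux needs: Mazur's main conjecture at `W₀` only needs the REVERSE μ-INEQUALITY `μ(ϖ·L) ≤ μ(char X)`
("μ-part", the X2 twin of `X1.MuLambda.MuPartAt`; Kato–Wuthrich being `≥`). This file proves, with
PUBLISHED inputs by name only (`hWu` Wuthrich 2014 Thm. 16, `hpar` modularity, `hGS` Greenberg–Stevens):

* §1 `mazurMainConjectureAt_of_muPart_of_lambdaCount` — the μ-TOLERANT route T: `ϖ·L ≠ 0` (a theorem
  at `r_an = 0`) ∧ μ-part ∧ λ-count ⇒ `X2.MazurMainConjectureAt W p` (`g = u·h·f_E`,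
  `μ(h) = μ(g) − μ(f_E) ≤ 0`, `λ(h) = n − e − λ(f_E) ≤ 0`, so `h ∈ Λˣ`).
* §2 the converses: MC ⇒ `μ(ϖ·L) = μ(char X)` for every datum (`mu_eq_mu_of_mazurMainConjectureAt`;
  no divisibility fact) ⇒ μ-part; MC ⇒ λ-count at `r_an = 0` with NO `μ`-certificate
  (`exists_lambdaCount_of_mazurMainConjectureAt_of_analyticRank_eq_zero`: lam-a g0's converse + the
  non-vanishing).
* §3 AT AN X2b PAIR: `X2.MazurMainConjectureAt W p ⟺ μ-part ∧ λ-count`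
  (`cellB_mazurMainConjectureAt_iff_muPart_and_lambdaCount`) — TIGHT: no Greenberg surplus, in the
  `(μ, λ)` currency of the cell's instruments (compare lam-a g0's
  `lambdaCount_iff_mazurMainConjectureAt`, which needs stub 3 at the pair).
* §4 THE REGISTERED μ-STUB'S CONCLUSION DECOMPOSED at `p ‖ N` (the X1-twin decomposition that
  `…CellBCongruenceRoadMuPart` §3 could not state for want of the non-vanishing):
  `X2.AnalyticMuLE W p 0 ⟺ μ-part ∧ (μ(X(W/ℚ_∞)) = 0 for every cyclotomic dual datum)`
  (`analyticMuLE_zero_iff_muPart_and_forall_mu_eq_zero`): stub 3 at `W₀` = [μ-part at `W₀`] +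
  [Greenberg Conj. 1.11 at `W₀`]; a re-cut of `mudescent` with stub 3′ := μ-part off the locus would be
  EQUIVALENT to the crux (third file) instead of crux + Greenberg.

HONEST FRAMING: theorems only (no `def`, no named fact, no `sorry`); nothing here proves the crux, a
stub, Greenberg's conjecture or BSD for any curve; 0 cells / 0 labels move; the skeleton of record is
NOT re-registered by this seat (a reshape is the LEAD's / owner's call; this file is kernel evidence).
References: [GreenbergVatsal2000] p. 2 (1)–(2), p. 4–5; [GreenbergLNM1716] Conj. 1.11 (p. 58), Cor.
5.6 (p. 136); [Wuthrich2014] Thm. 16 (p. 397); [MazurTateTeitelbaum1986] §I.14.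
-/

set_option autoImplicit false

-- `Summit.BirchSwinnertonDyer.BirchSwinnertonDyer.…`: the summit and its single sub-problem share a name (D-0017 layout).
set_option linter.dupNamespace false

noncomputable section

open scoped Classical MatrixGroups ModularForm

open PowerSeries CongruenceSubgroup WeierstrassCurve
  Literature.NumberTheory.EllipticCurves
  Literature.NumberTheory.EllipticCurves.ModularForms
  Literature.NumberTheory.EllipticCurves.Rank1Residual
  Literature.NumberTheory.EllipticCurves.Wuthrich2014
  Summit.BirchSwinnertonDyer.Rank1Residual
  Summit.BirchSwinnertonDyer.Rank1Residual.X1.MuLambda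
  Summit.BirchSwinnertonDyer.Rank1Residual.X1.MuPart
  Summit.BirchSwinnertonDyer.Rank1Residual.X1.ParitySqueeze
  Summit.BirchSwinnertonDyer.Rank1Residual.X1.TamagawaSqueeze
  Summit.BirchSwinnertonDyer.BirchSwinnertonDyer.Theorems.EisensteinPrimesX2AnalyticMuBound
  Summit.BirchSwinnertonDyer.BirchSwinnertonDyer.Theorems.EisensteinPrimesAnalyticLambdaCruxSized
  Summit.BirchSwinnertonDyer.BirchSwinnertonDyer.Theorems.EisensteinPrimesMazurMCOnCellBCongruenceRoadMuPart

namespace Summit.BirchSwinnertonDyer.BirchSwinnertonDyer.Theorems.EisensteinPrimesMazurMCOnCellBMuPartTight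

variable {W : WeierstrassCurve ℚ} [W.IsElliptic] [W.IsGloballyMinimal] {p : ℕ} [Fact p.Prime]

/-! ## §1. The μ-tolerant route T at `p ‖ N`

The «μ-part at `(W, p)`» is written INLINE (no definition in a proof file): for the cyclotomic `κ, γ`,
every newform `f` of `W`, every Néron-normalising `ϖ`, THE multiplicative Mazur–Tate–Teitelbaum `L`,
every dual datum `D`, every generator `g` of `char_Λ X(E/ℚ_∞)` and every `G ∈ Λ` with `ι(G) = ϖ·L`:
`μ(G) ≤ μ(g)` ("`μ_an ≤ μ_alg`", the X2 twin of `X1.MuLambda.MuPartAt`). -/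

/-- **Route T at an odd multiplicative Eisenstein prime, μ-TOLERANT form.** `W/ℚ` globally minimal,
`p ≠ 2` multiplicative, `E[p]` reducible; PUBLISHED: Wuthrich 2014 Thm. 16 (`hWu`). Data: the
non-vanishing `∃ m, X2.AnalyticMuLE W p m` (a theorem at `r_an = 0`:
`EisensteinPrimesX2AnalyticMuBound.exists_analyticMuLE_of_analyticRank_eq_zero`), the μ-PART
`μ(ϖ·L) ≤ μ(char X)` for every datum (`hμ`, inline), `X2.AnalyticLambdaEq W p n`,
`AlgebraicLambdaGE W p k`, `n ≤ k` (non-split) / `n ≤ k + 1` (split). Conclusion: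
`X2.MazurMainConjectureAt W p`. Proof: Thm. 16 gives `ι(T^e·g) = ϖ·L`, `g = h·f_E`, `char X = (f_E)`;
`μ(T^e·h·f_E) = μ(h) + μ(f_E) ≤ μ(f_E)` forces `μ(h) = 0`, `e + λ(h) + λ(f_E) = n ≤ k + e ≤ λ(f_E) + e`
forces `λ(h) = 0`; so `h ∈ Λˣ`. The tree's route T is the case `μ(ϖ·L) = 0` of `hμ`.
[cite: Wuthrich2014, Thm. 16 and §5 (p. 397)] [cite: GreenbergVatsal2000, p. 4 (after Thm. (1.2))]
[cite: GreenbergLNM1716, Cor. 5.6 (proof, p. 136)] -/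
theorem mazurMainConjectureAt_of_muPart_of_lambdaCount
    (hWu : thm16_charIdeal_dvd_multiplicative_of_reducible)
    (W : WeierstrassCurve ℚ) [W.IsElliptic] [W.IsGloballyMinimal] (p : ℕ) [Fact p.Prime]
    (hp2 : p ≠ 2) (hmult : W.HasMultiplicativeReductionAtPrime p)
    (hred : ¬ W.HasIrreducibleModPGaloisRep p) (hL0 : ∃ m : ℕ, X2.AnalyticMuLE W p m)
    (hμ : ∀ (κ : ZpExtension ℚ p) (γ : Field.absoluteGaloisGroup ℚ),
      κ.IsCyclotomic → κ.IsTopGenerator γ → IsCyclotomicVariable p γ →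
      ∀ {N : ℕ} [NeZero N] (f : CuspForm (Gamma0 N) 2), IsNewformOf W f →
      ∀ (ϖ : ℚ), (ϖ : ℝ) * W.realPeriodRat = plusPeriod f →
      ∀ (L : PowerSeries ℚ_[p]),
        (W.HasSplitMultiplicativeReductionAtPrime p → IsSplitMultPAdicLFunctionOf f p L) →
        (¬ W.HasSplitMultiplicativeReductionAtPrime p → IsMultPAdicLFunctionOf f p (-1) L) →
      ∀ (D : W.SelmerDualData κ γ) (g G : IwasawaAlgebra p), D.charIdeal = Ideal.span {g} →
        iwasawaToPowerSeries p G = PowerSeries.C ((ϖ : ℚ) : ℚ_[p]) * L → mu G ≤ mu g)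
    {n k : ℕ} (hlam : X2.AnalyticLambdaEq W p n) (halg : AlgebraicLambdaGE W p k)
    (hkN : ¬ W.HasSplitMultiplicativeReductionAtPrime p → n ≤ k)
    (hkS : W.HasSplitMultiplicativeReductionAtPrime p → n ≤ k + 1) :
    X2.MazurMainConjectureAt W p := by
  intro κ γ hκ hγ hγ' N _ f hf D ϖ hϖ
  haveI : Module.Finite (IwasawaAlgebra p) D.X := D.module_finite_holds hγ
  obtain ⟨m, hLm⟩ := hL0
  -- Wuthrich Thm. 16 at this datum; a generator `fE` of the characteristic ideal
  obtain ⟨hX, hKns, hKs⟩ := hWu W p hp2 hmult hred hκ hγ hγ' hf D ϖ hϖ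
  haveI : (Literature.NumberTheory.EllipticCurves.Module.charIdeal (IwasawaAlgebra p) D.X).IsPrincipal :=
    charIdeal_isPrincipal_holds p D.X
  obtain ⟨fE, hfE⟩ := Submodule.IsPrincipal.principal
    (Literature.NumberTheory.EllipticCurves.Module.charIdeal (IwasawaAlgebra p) D.X)
  have hchar : D.charIdeal = Ideal.span {fE} := hfE
  have hkfE : fE ≠ 0 → k ≤ lam fE := fun hfE0 ↦ by
    rw [lam_generator_eq_lambdaInvariant D.X hX hfE0 hchar]
    exact halg κ γ hκ hγ D hX
  -- how the data at `G = u · (h · fE)` finish (`u = T` or `u = 1`)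
  have finish : ∀ (u h : IwasawaAlgebra p) (e : ℕ) (L : PowerSeries ℚ_[p]), u ≠ 0 → lam u = e →
      mu u = 0 →
      (W.HasSplitMultiplicativeReductionAtPrime p → IsSplitMultPAdicLFunctionOf f p L) →
      (¬ W.HasSplitMultiplicativeReductionAtPrime p → IsMultPAdicLFunctionOf f p (-1) L) →
      iwasawaToPowerSeries p (u * (h * fE)) = PowerSeries.C ((ϖ : ℚ) : ℚ_[p]) * L →
      lam (u * (h * fE)) = n → n ≤ k + e → IsUnit h := by
    intro u h e L hu0 hlu hμu hLs hLn hG hlG hnk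
    obtain ⟨k', hk'⟩ := hLm f hf ϖ hϖ L hLs hLn
    have hL0' : PowerSeries.C ((ϖ : ℚ) : ℚ_[p]) * L ≠ 0 := X2.ne_zero_of_lt_norm_coeff hk'
    have hG0 : u * (h * fE) ≠ 0 := by
      intro h0; apply hL0'; rw [← hG, h0, map_zero]
    have hh0 : h ≠ 0 := fun h0 ↦ hG0 (by rw [h0, zero_mul, mul_zero])
    have hfE0 : fE ≠ 0 := fun h0 ↦ hG0 (by rw [h0, mul_zero, mul_zero])
    -- the μ-part at this datum: `μ(u·h·fE) ≤ μ(fE)`, so `μ(h) = 0`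
    have hμG : mu (u * (h * fE)) ≤ mu fE := hμ κ γ hκ hγ hγ' f hf ϖ hϖ L hLs hLn D fE _ hchar hG
    rw [mu_mul hu0 (mul_ne_zero hh0 hfE0), mu_mul hh0 hfE0, hμu] at hμG
    have hμh : mu h = 0 := by omega
    -- the λ-count: `e + λ(h) + λ(fE) = n ≤ k + e ≤ λ(fE) + e`, so `λ(h) = 0`
    rw [lam_mul hu0 (mul_ne_zero hh0 hfE0), lam_mul hh0 hfE0, hlu] at hlG
    have hk := hkfE hfE0
    have hlh : lam h = 0 := by omega
    exact (isUnit_iff_mu_eq_zero_and_lam_eq_zero h).mpr ⟨hh0, hμh, hlh⟩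
  refine ⟨hX, fE, hchar, fun hsplit L hL => ?_, fun hns L hL => ?_⟩
  · -- SPLIT `p`: `ι(T · g) = ϖ · L`, `g = h · fE`
    obtain ⟨g, hgmem, hιg⟩ := hKs hsplit L hL
    have hgmem' : g ∈ Ideal.span {fE} := by rw [← hchar]; exact hgmem
    obtain ⟨h, hgh⟩ := Ideal.mem_span_singleton'.mp hgmem'
    have hG : iwasawaToPowerSeries p (PowerSeries.X * (h * fE)) =
        PowerSeries.C ((ϖ : ℚ) : ℚ_[p]) * L := by rw [hgh]; exact hιg
    have hlG : lam (PowerSeries.X * (h * fE)) = n :=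
      hlam f hf ϖ hϖ L (fun _ ↦ hL) (fun hns ↦ absurd hsplit hns) _ hG
    have hunit : IsUnit h := finish PowerSeries.X h 1 L PowerSeries.X_ne_zero X2.lam_X
      X2.mu_X_eq_zero_and_pfree_X.1 (fun _ ↦ hL) (fun hns ↦ absurd hsplit hns) hG hlG (hkS hsplit)
    refine ⟨hunit.unit, ?_⟩
    rw [IsUnit.unit_spec, show (PowerSeries.X : IwasawaAlgebra p) * fE * h = PowerSeries.X * g by
      rw [← hgh]; ring]
    exact hιg
  · -- NON-SPLIT `p`: `ι(g) = ϖ · L`, `g = h · fE`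
    obtain ⟨g, hgmem, hιg⟩ := hKns hns L hL
    have hgmem' : g ∈ Ideal.span {fE} := by rw [← hchar]; exact hgmem
    obtain ⟨h, hgh⟩ := Ideal.mem_span_singleton'.mp hgmem'
    have hG : iwasawaToPowerSeries p (1 * (h * fE)) = PowerSeries.C ((ϖ : ℚ) : ℚ_[p]) * L := by
      rw [one_mul, hgh]; exact hιg
    have hlG : lam (1 * (h * fE)) = n :=
      hlam f hf ϖ hϖ L (fun hsplit ↦ absurd hsplit hns) (fun _ ↦ hL) _ hG
    have hunit : IsUnit h := finish 1 h 0 L one_ne_zero (lam_eq_zero_of_isUnit isUnit_one)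
      (X2.mu_eq_zero_of_isUnit isUnit_one) (fun hsplit ↦ absurd hsplit hns) (fun _ ↦ hL) hG hlG
      (by simpa using hkN hns)
    refine ⟨hunit.unit, ?_⟩
    rw [IsUnit.unit_spec, show fE * h = g by rw [← hgh]; ring]
    exact hιg

/-! ## §2. The converses: Mazur's main conjecture gives the μ-part (indeed μ-equality) and the λ-count -/

/-- **Under Mazur's main conjecture at a multiplicative pair, `μ(ϖ·L) = μ(char X)` for every datum**
(no divisibility fact): `char X = (g') = (g)` and `ι(T^e·g'·w) = ϖ·L = ι(G)` with `w ∈ Λˣ`, so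
`G = T^e·g'·w` (`ι` injective) and `μ(G) = μ(g') = μ(g)` (`μ(T) = μ(w) = 0`; `g ~ g'`). The data are
quantified exactly as in the μ-part. [cite: GreenbergVatsal2000, p. 2 (1)–(2), p. 4] [cite: MazurTateTeitelbaum1986, §I.14 (shape)] -/
theorem mu_eq_mu_of_mazurMainConjectureAt (hMC : X2.MazurMainConjectureAt W p)
    {κ : ZpExtension ℚ p} {γ : Field.absoluteGaloisGroup ℚ}
    (hκ : κ.IsCyclotomic) (hγ : κ.IsTopGenerator γ) (hγ' : IsCyclotomicVariable p γ)
    {N : ℕ} [NeZero N] {f : CuspForm (Gamma0 N) 2} (hf : IsNewformOf W f)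
    {ϖ : ℚ} (hϖ : (ϖ : ℝ) * W.realPeriodRat = plusPeriod f) {L : PowerSeries ℚ_[p]}
    (hLs : W.HasSplitMultiplicativeReductionAtPrime p → IsSplitMultPAdicLFunctionOf f p L)
    (hLn : ¬ W.HasSplitMultiplicativeReductionAtPrime p → IsMultPAdicLFunctionOf f p (-1) L)
    (D : W.SelmerDualData κ γ) {g G : IwasawaAlgebra p} (hchar : D.charIdeal = Ideal.span {g})
    (hG : iwasawaToPowerSeries p G = PowerSeries.C ((ϖ : ℚ) : ℚ_[p]) * L) : mu G = mu g := by
  haveI : Module.Finite (IwasawaAlgebra p) D.X := D.module_finite_holds hγ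
  obtain ⟨-, g', hchar', hS, hNS⟩ := hMC κ γ hκ hγ hγ' f hf D ϖ hϖ
  have hg'0 : g' ≠ 0 := by
    intro h0
    apply Literature.NumberTheory.EllipticCurves.Module.charIdeal_ne_bot (IwasawaAlgebra p) D.X
    change D.charIdeal = ⊥
    rw [hchar', h0, Ideal.span_singleton_eq_bot]
  -- `g` and `g'` generate the same ideal: `g' * v = g` with `v` a unit
  have hspan : Ideal.span ({g'} : Set (IwasawaAlgebra p)) = Ideal.span {g} := by rw [← hchar', hchar]
  obtain ⟨v, hv⟩ := Ideal.span_singleton_eq_span_singleton.mp hspan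
  have hμgg' : mu g = mu g' := by
    rw [← hv, mu_mul hg'0 v.ne_zero, X2.mu_eq_zero_of_isUnit v.isUnit, add_zero]
  have hX0 : (PowerSeries.X : IwasawaAlgebra p) ≠ 0 := PowerSeries.X_ne_zero
  rw [hμgg']
  by_cases hs : W.HasSplitMultiplicativeReductionAtPrime p
  · obtain ⟨w, hw⟩ := hS hs L (hLs hs)
    have hGe : G = PowerSeries.X * g' * (w : IwasawaAlgebra p) :=
      iwasawaToPowerSeries_injective p (by rw [hG, hw])
    rw [hGe, mu_mul (mul_ne_zero hX0 hg'0) w.ne_zero, mu_mul hX0 hg'0, X2.mu_X_eq_zero_and_pfree_X.1,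
      X2.mu_eq_zero_of_isUnit w.isUnit]
    ring
  · obtain ⟨w, hw⟩ := hNS hs L (hLn hs)
    have hGe : G = g' * (w : IwasawaAlgebra p) := iwasawaToPowerSeries_injective p (by rw [hG, hw])
    rw [hGe, mu_mul hg'0 w.ne_zero, X2.mu_eq_zero_of_isUnit w.isUnit, add_zero]

/-- **Mazur's main conjecture at the pair ⇒ the μ-part** (the inline predicate, from
`mu_eq_mu_of_mazurMainConjectureAt`). [cite: GreenbergVatsal2000, p. 4 (after Thm. (1.2))] -/
theorem muPart_of_mazurMainConjectureAt (hMC : X2.MazurMainConjectureAt W p) :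
    ∀ (κ : ZpExtension ℚ p) (γ : Field.absoluteGaloisGroup ℚ),
      κ.IsCyclotomic → κ.IsTopGenerator γ → IsCyclotomicVariable p γ →
      ∀ {N : ℕ} [NeZero N] (f : CuspForm (Gamma0 N) 2), IsNewformOf W f →
      ∀ (ϖ : ℚ), (ϖ : ℝ) * W.realPeriodRat = plusPeriod f →
      ∀ (L : PowerSeries ℚ_[p]),
        (W.HasSplitMultiplicativeReductionAtPrime p → IsSplitMultPAdicLFunctionOf f p L) →
        (¬ W.HasSplitMultiplicativeReductionAtPrime p → IsMultPAdicLFunctionOf f p (-1) L) →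
      ∀ (D : W.SelmerDualData κ γ) (g G : IwasawaAlgebra p), D.charIdeal = Ideal.span {g} →
        iwasawaToPowerSeries p G = PowerSeries.C ((ϖ : ℚ) : ℚ_[p]) * L → mu G ≤ mu g :=
  fun _ _ hκ hγ hγ' _ _ _ hf _ hϖ _ hLs hLn D _ _ hchar hG ↦
    (mu_eq_mu_of_mazurMainConjectureAt hMC hκ hγ hγ' hf hϖ hLs hLn D hchar hG).le

/-- **Mazur's main conjecture at a rank-`0` multiplicative pair ⇒ the λ-count, with NO μ-certificate**
(`p ≠ 2`; modularity `hpar`, Greenberg–Stevens `hGS`): lam-a g0's converse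
`exists_lambdaCount_of_mazurMainConjectureAt` read its `ϖ·L ≠ 0` off a hypothesis `X2.AnalyticMuLE W p m`;
at `r_an = 0` that hypothesis is the theorem `exists_analyticMuLE_of_analyticRank_eq_zero`.
[cite: GreenbergVatsal2000, p. 4 (after Thm. (1.2))] [cite: MazurTateTeitelbaum1986, §I.14–I.15] -/
theorem exists_lambdaCount_of_mazurMainConjectureAt_of_analyticRank_eq_zero
    (hpar : nonempty_modularParametrizationData) (hp2 : p ≠ 2)
    (hGS : greenberg_stevens (W := W) (p := p)) (hmult : W.HasMultiplicativeReductionAtPrime p)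
    (hr0 : W.analyticRank = 0) (hMC : X2.MazurMainConjectureAt W p) :
    ∃ n k : ℕ, X2.AnalyticLambdaEq W p n ∧ AlgebraicLambdaGE W p k ∧
      (¬ W.HasSplitMultiplicativeReductionAtPrime p → n ≤ k) ∧
      (W.HasSplitMultiplicativeReductionAtPrime p → n ≤ k + 1) := by
  obtain ⟨m, hμ⟩ := exists_analyticMuLE_of_analyticRank_eq_zero hpar hp2 hGS hr0
  exact exists_lambdaCount_of_mazurMainConjectureAt hpar hmult hμ hMC

/-! ## §3. At an X2b pair: Mazur's main conjecture ⟺ μ-part ∧ λ-count (TIGHT) -/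

/-- **At a rank-`0` odd multiplicative Eisenstein pair: `X2.MazurMainConjectureAt W p` ⟺
(μ-part ∧ λ-count)** — the TIGHT `(μ, λ)` form of Mazur's main conjecture at the pair (no `μ_an = 0`
input; compare `EisensteinPrimesAnalyticLambdaCruxSized.lambdaCount_iff_mazurMainConjectureAt`, which
needs stub 3 at the pair). PUBLISHED: `hWu`, `hpar`, `hGS`. [cite: Wuthrich2014, Thm. 16 (p. 397)]
[cite: GreenbergVatsal2000, p. 4 (after Thm. (1.2))] -/
theorem mazurMainConjectureAt_iff_muPart_and_lambdaCount
    (hWu : thm16_charIdeal_dvd_multiplicative_of_reducible)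
    (hpar : nonempty_modularParametrizationData) (hGS : greenberg_stevens (W := W) (p := p))
    (hp2 : p ≠ 2) (hmult : W.HasMultiplicativeReductionAtPrime p)
    (hred : ¬ W.HasIrreducibleModPGaloisRep p) (hr0 : W.analyticRank = 0) :
    X2.MazurMainConjectureAt W p ↔
      ((∀ (κ : ZpExtension ℚ p) (γ : Field.absoluteGaloisGroup ℚ),
        κ.IsCyclotomic → κ.IsTopGenerator γ → IsCyclotomicVariable p γ →
        ∀ {N : ℕ} [NeZero N] (f : CuspForm (Gamma0 N) 2), IsNewformOf W f →
        ∀ (ϖ : ℚ), (ϖ : ℝ) * W.realPeriodRat = plusPeriod f →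
        ∀ (L : PowerSeries ℚ_[p]),
          (W.HasSplitMultiplicativeReductionAtPrime p → IsSplitMultPAdicLFunctionOf f p L) →
          (¬ W.HasSplitMultiplicativeReductionAtPrime p → IsMultPAdicLFunctionOf f p (-1) L) →
        ∀ (D : W.SelmerDualData κ γ) (g G : IwasawaAlgebra p), D.charIdeal = Ideal.span {g} →
          iwasawaToPowerSeries p G = PowerSeries.C ((ϖ : ℚ) : ℚ_[p]) * L → mu G ≤ mu g) ∧
      ∃ n k : ℕ, X2.AnalyticLambdaEq W p n ∧ AlgebraicLambdaGE W p k ∧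
        (¬ W.HasSplitMultiplicativeReductionAtPrime p → n ≤ k) ∧
        (W.HasSplitMultiplicativeReductionAtPrime p → n ≤ k + 1)) :=
  ⟨fun hMC ↦ ⟨muPart_of_mazurMainConjectureAt hMC,
      exists_lambdaCount_of_mazurMainConjectureAt_of_analyticRank_eq_zero hpar hp2 hGS hmult hr0 hMC⟩,
    fun ⟨hμ, _, _, hlam, halg, hkN, hkS⟩ ↦
      mazurMainConjectureAt_of_muPart_of_lambdaCount hWu W p hp2 hmult hred
        (exists_analyticMuLE_of_analyticRank_eq_zero hpar hp2 hGS hr0) hμ hlam halg hkN hkS⟩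

/-- **On sub-cell X2b (`X2.CellB W p`): Mazur's main conjecture at the pair ⟺ μ-part ∧ λ-count**
(`p ≠ 2`, multiplicativity, reducibility, `r_an = 0` read off `CellB`; `¬ GVPar` unused).
[cite: Wuthrich2014, Thm. 16 (p. 397)] [cite: GreenbergVatsal2000, p. 4–5] -/
theorem cellB_mazurMainConjectureAt_iff_muPart_and_lambdaCount
    (hWu : thm16_charIdeal_dvd_multiplicative_of_reducible)
    (hpar : nonempty_modularParametrizationData) (hGS : greenberg_stevens (W := W) (p := p))
    (hc : X2.CellB W p) :
    X2.MazurMainConjectureAt W p ↔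
      ((∀ (κ : ZpExtension ℚ p) (γ : Field.absoluteGaloisGroup ℚ),
        κ.IsCyclotomic → κ.IsTopGenerator γ → IsCyclotomicVariable p γ →
        ∀ {N : ℕ} [NeZero N] (f : CuspForm (Gamma0 N) 2), IsNewformOf W f →
        ∀ (ϖ : ℚ), (ϖ : ℝ) * W.realPeriodRat = plusPeriod f →
        ∀ (L : PowerSeries ℚ_[p]),
          (W.HasSplitMultiplicativeReductionAtPrime p → IsSplitMultPAdicLFunctionOf f p L) →
          (¬ W.HasSplitMultiplicativeReductionAtPrime p → IsMultPAdicLFunctionOf f p (-1) L) →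
        ∀ (D : W.SelmerDualData κ γ) (g G : IwasawaAlgebra p), D.charIdeal = Ideal.span {g} →
          iwasawaToPowerSeries p G = PowerSeries.C ((ϖ : ℚ) : ℚ_[p]) * L → mu G ≤ mu g) ∧
      ∃ n k : ℕ, X2.AnalyticLambdaEq W p n ∧ AlgebraicLambdaGE W p k ∧
        (¬ W.HasSplitMultiplicativeReductionAtPrime p → n ≤ k) ∧
        (W.HasSplitMultiplicativeReductionAtPrime p → n ≤ k + 1)) :=
  mazurMainConjectureAt_iff_muPart_and_lambdaCount hWu hpar hGS hc.2.1.1 hc.2.1.2.2 hc.2.1.2.1 hc.1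

/-! ## §4. The registered μ-stub, decomposed: `μ_an = 0 ⟺ μ-part ∧ μ(X(E/ℚ_∞)) = 0` -/

/-- **At a rank-`0` odd multiplicative Eisenstein pair: `X2.AnalyticMuLE W p 0` ⟺
(μ-part at `(W,p)`) ∧ (`μ(X(W/ℚ_∞)) = 0` for every cyclotomic dual datum).** `→`: `μ(G) = 0 ≤ μ(g)`
(unit coefficient, `X1.MuPart.mu_le_of_lt_norm_coeff`) and Kato–Wuthrich `μ(X) ≤ μ_an = 0`
(`X2.isTorsion_and_mu_eq_zero_of_analyticMuLE_zero`). `←`: Thm. 16 gives `ι(T^e·g') = ϖ·L`,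
`g' ∈ (f_E) = char X`; `T^e·g' ≠ 0` by the NON-VANISHING at `r_an = 0` (file 1), so `f_E ≠ 0` and
`μ(T^e·g') ≤ μ(f_E) = μ(X) = 0` (`mu_generator_eq_muInvariant`): a coefficient of `ϖ·L` is a unit
(`exists_lt_norm_coeff_of_mu_eq_zero`) — the decomposition «stub ⟺ (μ-part) ∧ (Greenberg)» that
`…CellBCongruenceRoadMuPart` §3 left unstated at `p ‖ N`.
[cite: Wuthrich2014, Thm. 16 (p. 397)] [cite: GreenbergVatsal2000, p. 2 (1)–(2)]
[cite: GreenbergLNM1716, Conj. 1.11 (p. 58)] -/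
theorem analyticMuLE_zero_iff_muPart_and_forall_mu_eq_zero
    (hWu : thm16_charIdeal_dvd_multiplicative_of_reducible)
    (hpar : nonempty_modularParametrizationData) (hGS : greenberg_stevens (W := W) (p := p))
    (hp2 : p ≠ 2) (hmult : W.HasMultiplicativeReductionAtPrime p)
    (hred : ¬ W.HasIrreducibleModPGaloisRep p) (hr0 : W.analyticRank = 0) :
    X2.AnalyticMuLE W p 0 ↔
      ((∀ (κ : ZpExtension ℚ p) (γ : Field.absoluteGaloisGroup ℚ),
        κ.IsCyclotomic → κ.IsTopGenerator γ → IsCyclotomicVariable p γ →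
        ∀ {N : ℕ} [NeZero N] (f : CuspForm (Gamma0 N) 2), IsNewformOf W f →
        ∀ (ϖ : ℚ), (ϖ : ℝ) * W.realPeriodRat = plusPeriod f →
        ∀ (L : PowerSeries ℚ_[p]),
          (W.HasSplitMultiplicativeReductionAtPrime p → IsSplitMultPAdicLFunctionOf f p L) →
          (¬ W.HasSplitMultiplicativeReductionAtPrime p → IsMultPAdicLFunctionOf f p (-1) L) →
        ∀ (D : W.SelmerDualData κ γ) (g G : IwasawaAlgebra p), D.charIdeal = Ideal.span {g} →
          iwasawaToPowerSeries p G = PowerSeries.C ((ϖ : ℚ) : ℚ_[p]) * L → mu G ≤ mu g) ∧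
      ∀ (κ : ZpExtension ℚ p) (γ : Field.absoluteGaloisGroup ℚ),
        κ.IsCyclotomic → κ.IsTopGenerator γ → IsCyclotomicVariable p γ →
        ∀ D : W.SelmerDualData κ γ, D.mu = 0) := by
  constructor
  · intro hμ0
    refine ⟨fun κ γ _ _ _ N _ f hf ϖ hϖ L hLs hLn D g G _ hG ↦ ?_, fun κ γ hκ hγ hγ' D ↦
      (X2.isTorsion_and_mu_eq_zero_of_analyticMuLE_zero hWu hpar hp2 hmult hred hμ0 hκ hγ hγ' D).2⟩
    obtain ⟨k, hk⟩ := hμ0 f hf ϖ hϖ L hLs hLn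
    rw [← hG] at hk
    have : mu G ≤ 0 := mu_le_of_lt_norm_coeff hk
    omega
  · rintro ⟨hμ, hGr⟩
    intro N _ f hf ϖ hϖ L hLs hLn
    obtain ⟨κ, hκ, γ, hγ, hγ'⟩ := exists_isCyclotomic_isTopGenerator_isCyclotomicVariable_holds p
    obtain ⟨D⟩ := W.nonempty_selmerDualData_holds κ γ hγ
    haveI : Module.Finite (IwasawaAlgebra p) D.X := D.module_finite_holds hγ
    obtain ⟨hX, hKns, hKs⟩ := hWu W p hp2 hmult hred hκ hγ hγ' hf D ϖ hϖ
    haveI : (Literature.NumberTheory.EllipticCurves.Module.charIdeal (IwasawaAlgebra p) D.X).IsPrincipal :=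
      charIdeal_isPrincipal_holds p D.X
    obtain ⟨fE, hfE⟩ := Submodule.IsPrincipal.principal
      (Literature.NumberTheory.EllipticCurves.Module.charIdeal (IwasawaAlgebra p) D.X)
    have hchar : D.charIdeal = Ideal.span {fE} := hfE
    have hμX : D.mu = 0 := hGr κ γ hκ hγ hγ' D
    -- Wuthrich's integral element `G = u · g'` (`u = T` split, `u = 1` non-split), `g' ∈ (fE)`
    have key : ∃ G : IwasawaAlgebra p, (∃ h : IwasawaAlgebra p, ∃ u : IwasawaAlgebra p, G = u * (h * fE)) ∧
        iwasawaToPowerSeries p G = PowerSeries.C ((ϖ : ℚ) : ℚ_[p]) * L := by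
      by_cases hs : W.HasSplitMultiplicativeReductionAtPrime p
      · obtain ⟨g, hgmem, hιg⟩ := hKs hs L (hLs hs)
        have hgmem' : g ∈ Ideal.span {fE} := by rw [← hchar]; exact hgmem
        obtain ⟨h, hgh⟩ := Ideal.mem_span_singleton'.mp hgmem'
        exact ⟨PowerSeries.X * g, ⟨h, PowerSeries.X, by rw [hgh]⟩, hιg⟩
      · obtain ⟨g, hgmem, hιg⟩ := hKns hs L (hLn hs)
        have hgmem' : g ∈ Ideal.span {fE} := by rw [← hchar]; exact hgmem
        obtain ⟨h, hgh⟩ := Ideal.mem_span_singleton'.mp hgmem'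
        exact ⟨g, ⟨h, 1, by rw [one_mul, hgh]⟩, hιg⟩
    obtain ⟨G, ⟨h, u, hGfac⟩, hιG⟩ := key
    have hG0 : G ≠ 0 :=
      ne_zero_of_iwasawaToPowerSeries_eq_of_analyticRank_eq_zero hpar hp2 hGS hr0 hf hϖ hLs hLn hιG
    have hfE0 : fE ≠ 0 := fun h0 ↦ hG0 (by rw [hGfac, h0, mul_zero, mul_zero])
    have hμfE : mu fE = 0 := by
      rw [mu_generator_eq_muInvariant D.X hX hfE0 hchar]
      exact hμX
    have hμG : mu G = 0 := by
      have := hμ κ γ hκ hγ hγ' f hf ϖ hϖ L hLs hLn D fE G hchar hιG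
      omega
    exact exists_lt_norm_coeff_of_mu_eq_zero hG0 hμG hιG

/-- **A `μ_an = 0` certificate discharges the μ-part at the pair, with NO named fact**: `μ(G) = 0 ≤ μ(g)`
(`X1.MuPart.mu_le_of_lt_norm_coeff`); so every per-pair `μ_an = 0` reading certifies the re-cut stub
3′ «μ-part off the locus» exactly as it certified stub 3. [cite: GreenbergVatsal2000, p. 2, (2)] -/
theorem muPart_of_analyticMuLE_zero (hμ0 : X2.AnalyticMuLE W p 0) :
    ∀ (κ : ZpExtension ℚ p) (γ : Field.absoluteGaloisGroup ℚ),
      κ.IsCyclotomic → κ.IsTopGenerator γ → IsCyclotomicVariable p γ →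
      ∀ {N : ℕ} [NeZero N] (f : CuspForm (Gamma0 N) 2), IsNewformOf W f →
      ∀ (ϖ : ℚ), (ϖ : ℝ) * W.realPeriodRat = plusPeriod f →
      ∀ (L : PowerSeries ℚ_[p]),
        (W.HasSplitMultiplicativeReductionAtPrime p → IsSplitMultPAdicLFunctionOf f p L) →
        (¬ W.HasSplitMultiplicativeReductionAtPrime p → IsMultPAdicLFunctionOf f p (-1) L) →
      ∀ (D : W.SelmerDualData κ γ) (g G : IwasawaAlgebra p), D.charIdeal = Ideal.span {g} →
        iwasawaToPowerSeries p G = PowerSeries.C ((ϖ : ℚ) : ℚ_[p]) * L → mu G ≤ mu g := by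
  intro κ γ _ _ _ N _ f hf ϖ hϖ L hLs hLn D g G _ hG
  obtain ⟨k, hk⟩ := hμ0 f hf ϖ hϖ L hLs hLn
  rw [← hG] at hk
  have : mu G ≤ 0 := mu_le_of_lt_norm_coeff hk
  omega

end Summit.BirchSwinnertonDyer.BirchSwinnertonDyer.Theorems.EisensteinPrimesMazurMCOnCellBMuPartTight

end
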